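import Summits.ResolutionOfSingularities.ResolutionOfSingularities.Theorems.RadicialJungCleanModelsSufficeChartsStalkIso
import Mathlib.FieldTheory.PurelyInseparable.Basic
import HarnessLib

/-!
# Crux `Picover` (stmt-ResolutionOfSingularities-0554), line `degree-p-tower`:
# the stalks of `W^L` are the integral closures of the stalks of `W` (glue lemma A2)

Setting: `W` an integral scheme, `L` a field extension of `K(W)`, `W^L = normalizationIn W L` the
normalization of `W` in `L` (Mathlib's relative normalization of `Spec L → W`) with structure map
`ι = normalizationInι W L : W^L → W`, `x ∈ W^L` over `w = ι x`, and `L` an `𝒪_{W,w}`-algebra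
through `𝒪_{W,w} → K(W) → L`.

**What is true and what is not.** The points of `W^L` over `w` are the maximal ideals of
`A' = integralClosure 𝒪_{W,w} L` (normalization commutes with localisation), and `𝒪_{W^L,x}` is
the localisation of `A'` at the maximal ideal of `x`
(`RadicialJung.CleanResolves.exists_ringEquiv_stalk_normalizationIn`). Hence the LOCAL ring
`𝒪_{W^L,x}` is isomorphic to `A'` iff `A'` is local iff `x` is the only point over `w`. Without a
hypothesis forcing this the identification fails: for `W = Spec ℤ`, `L = ℚ(i)` and `w = (5)`,
which splits in `ℤ[i]`, `A' = ℤ[i] ⊗ ℤ₍₅₎` has the two maximal ideals `(2 ± i)`; and even for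
`L = K(W)` it fails at a non-normal point (`W` a nodal cubic, `w` the node: `A'` is the
semilocal ring of the two branches). So one needs BOTH that `L/K(W)` be purely inseparable and
that `𝒪_{W,w}` be integrally closed — exactly the situation of the kernel of the line
(`W` regular, `L/K(W)` purely inseparable of degree `p`).

**Content.**

* `isLocalRing_integralClosure_of_isPurelyInseparable` — for `O` local and integrally closed in
  its fraction field `K` and `L/K` purely inseparable, `integralClosure O L` is local: every
  `s` in it has `s ^ (q ^ n) ∈ O`, so any maximal ideal is contained in any other one.
* `stalkToField_stalkMap` — the value in `L` of `ι^♯_x(z)` for a germ `z ∈ 𝒪_{W,w}` is the image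
  of `z` under `𝒪_{W,w} → K(W) → L`.
* `nonempty_stalk_normalizationIn_iso_of_isLocalRing` — if `integralClosure 𝒪_{W,w} L` is local
  there is an isomorphism `e : 𝒪_{W^L,x} ≅ integralClosure 𝒪_{W,w} L` with
  `ι^♯_x ≫ e = algebraMap` (the ring isomorphism of
  `RadicialJung.CleanModelsSuffice.exists_ringEquiv_stalk_integralClosure`, whose values in `L`
  are known, plus `stalkToField_stalkMap`).
* `nonempty_stalk_normalizationIn_iso_of_isPurelyInseparable` — the registered form: `L/K(W)`
  purely inseparable and `𝒪_{W,w}` integrally closed.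
-/

noncomputable section

set_option linter.dupNamespace false -- mandated namespace of this single-conjunct summit

open CategoryTheory AlgebraicGeometry TopologicalSpace
open Literature.AlgebraicGeometry.Resolution
open Summit.ResolutionOfSingularities.ResolutionOfSingularities.Theorems.RadicialJung.CleanModelsSuffice

namespace Summit.ResolutionOfSingularities.ResolutionOfSingularities.Theorems.Picover.StalkNormalizationIn

universe u

/-! ## A purely inseparable integral closure of an integrally closed local domain is local -/

/-- **The integral closure of an integrally closed local domain in a purely inseparable
extension of its fraction field is local.** For `s ∈ integralClosure O L` some power
`s ^ (q ^ n)` (`q` the exponential characteristic) lies in `K`, is integral over `O`, hence lies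
in `O`; so if `M₁, M₂` are maximal ideals (both contracting to the maximal ideal of `O`) and
`s ∈ M₁` then `s ^ (q ^ n) ∈ M₂`, i.e. `s ∈ M₂`: all maximal ideals coincide. [folklore] -/
theorem isLocalRing_integralClosure_of_isPurelyInseparable (O K L : Type*) [CommRing O]
    [IsLocalRing O] [Field K] [Algebra O K] [IsFractionRing O K] [IsIntegrallyClosed O]
    [Field L] [Algebra K L] [Algebra O L] [IsScalarTower O K L] [IsPurelyInseparable K L] :
    IsLocalRing (integralClosure O L) := by
  obtain ⟨q, hq⟩ := ExpChar.exists K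
  -- every element of the integral closure has a `q ^ n`-th power coming from `O`
  have hpow : ∀ s : integralClosure O L,
      ∃ n : ℕ, s ^ q ^ n ∈ (algebraMap O (integralClosure O L)).range := by
    intro s
    obtain ⟨n, k, hk⟩ := IsPurelyInseparable.pow_mem K q (s : L)
    have hs : IsIntegral O (s : L) := s.2
    have hkint : IsIntegral O k := by
      have h1 : IsIntegral O ((s : L) ^ q ^ n) := hs.pow _
      rw [← hk] at h1
      exact (isIntegral_algebraMap_iff (algebraMap K L).injective).mp h1
    obtain ⟨o, ho⟩ := IsIntegrallyClosed.algebraMap_eq_of_integral (K := K) hkint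
    refine ⟨n, o, Subtype.ext ?_⟩
    change algebraMap O L o = (s : L) ^ q ^ n
    rw [IsScalarTower.algebraMap_apply O K L, ho, hk]
  -- every maximal ideal contracts to the maximal ideal of `O`
  have hcomap : ∀ M : Ideal (integralClosure O L), M.IsMaximal →
      M.comap (algebraMap O (integralClosure O L)) = IsLocalRing.maximalIdeal O := by
    intro M hM
    exact IsLocalRing.eq_maximalIdeal (Ideal.isMaximal_comap_of_isIntegral_of_isMaximal M)
  -- hence any maximal ideal is contained in any other one
  have hle : ∀ M₁ M₂ : Ideal (integralClosure O L), M₁.IsMaximal → M₂.IsMaximal → M₁ ≤ M₂ := by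
    intro M₁ M₂ hM₁ hM₂ s hs
    obtain ⟨n, r, hr⟩ := hpow s
    have hr₁ : r ∈ M₁.comap (algebraMap O (integralClosure O L)) := by
      rw [Ideal.mem_comap, hr]
      exact M₁.pow_mem_of_mem hs _ (pow_pos (expChar_pos K q) n)
    rw [hcomap M₁ hM₁, ← hcomap M₂ hM₂, Ideal.mem_comap, hr] at hr₁
    exact hM₂.isPrime.mem_of_pow_mem _ hr₁
  obtain ⟨M, hM⟩ := Ideal.exists_maximal (integralClosure O L)
  exact IsLocalRing.of_unique_max_ideal
    ⟨M, hM, fun N hN => hN.eq_of_le hM.ne_top (hle N M hN hM)⟩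

/-! ## The stalk map of `ι : W^L → W` read in `L` -/

variable (V : Scheme.{u}) [IsIntegral V] (L : Type u) [Field L] [Algebra V.functionField L]

/-- **`ι^♯_x` read in `L`**: for a germ `z ∈ 𝒪_{W, ι x}`, the value in `L` of its image in
`𝒪_{W^L, x}` (`stalkToField`, through the stalk of `Spec L → W^L` at the generic point) is the
image of `z` under `𝒪_{W, ι x} → K(W) → L` — both are computed on sections `r ∈ Γ(W, U)` by
`sectionToField_app`. [folklore] -/
theorem stalkToField_stalkMap (x : normalizationIn V L)
    (z : V.presheaf.stalk (normalizationInι V L x)) :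
    stalkToField V L x ((normalizationInι V L).stalkMap x z) =
      algebraMap V.functionField L
        (algebraMap (V.presheaf.stalk (normalizationInι V L x)) V.functionField z) := by
  -- both sides are ring maps out of the stalk `𝒪_{W, ι x}`; compare them on germs
  let F₁ : V.presheaf.stalk (normalizationInι V L x) ⟶ CommRingCat.of L :=
    (normalizationInι V L).stalkMap x ≫ CommRingCat.ofHom (stalkToField V L x)
  let F₂ : V.presheaf.stalk (normalizationInι V L x) ⟶ CommRingCat.of L :=
    CommRingCat.ofHom ((algebraMap V.functionField L).comp
      (algebraMap (V.presheaf.stalk (normalizationInι V L x)) V.functionField))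
  suffices h : F₁ = F₂ by
    exact congrArg (fun φ : V.presheaf.stalk (normalizationInι V L x) ⟶ CommRingCat.of L =>
      φ.hom z) h
  refine TopCat.Presheaf.stalk_hom_ext _ fun U hxU => ?_
  haveI : Nonempty U := ⟨⟨_, hxU⟩⟩
  ext r
  change stalkToField V L x ((normalizationInι V L).stalkMap x
      (V.presheaf.germ U (normalizationInι V L x) hxU r)) =
    algebraMap V.functionField L (algebraMap (V.presheaf.stalk (normalizationInι V L x))
      V.functionField (V.presheaf.germ U (normalizationInι V L x) hxU r))
  rw [Scheme.Hom.germ_stalkMap_apply, stalkToField_germ, sectionToField_app V L ⟨_, hxU⟩ r,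
    Scheme.algebraMap_germ_eq_germToFunctionField]

/-! ## The stalks of `W^L` as integral closures, compatibly with the stalk map -/

/-- **The local ring of `W^L` at `x` is the integral closure of `𝒪_{W, ι x}` in `L`, compatibly
with `ι^♯_x`, as soon as that integral closure is local.** The ring isomorphism is
`exists_ringEquiv_stalk_integralClosure` (Liu 2002, Def. 4.1.24: over an affine `U = Spec A ∋ ι x`,
`ι⁻¹U = Spec` of the integral closure `A'` of `A` in `L`, the stalk is `A'` localised at the prime
of `x`, integral closure commutes with localisation, and a local integral closure is its own
localisation); its values in `L` are given by `stalkToField`, and `stalkToField_stalkMap`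
identifies the composite with `ι^♯_x` as the structure map. [cite: Liu2002, Def. 4.1.24, p. 155] -/
theorem nonempty_stalk_normalizationIn_iso_of_isLocalRing (x : normalizationIn V L)
    [Algebra (V.presheaf.stalk (normalizationInι V L x)) L]
    [IsScalarTower (V.presheaf.stalk (normalizationInι V L x)) V.functionField L]
    [IsLocalRing (integralClosure (V.presheaf.stalk (normalizationInι V L x)) L)] :
    ∃ e : (normalizationIn V L).presheaf.stalk x ≅
        CommRingCat.of (integralClosure (V.presheaf.stalk (normalizationInι V L x)) L),
      (normalizationInι V L).stalkMap x ≫ e.hom =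
        CommRingCat.ofHom (algebraMap (V.presheaf.stalk (normalizationInι V L x))
          (integralClosure (V.presheaf.stalk (normalizationInι V L x)) L)) := by
  obtain ⟨e, he⟩ := exists_ringEquiv_stalk_integralClosure V L x
  refine ⟨e.toCommRingCatIso, ?_⟩
  refine CommRingCat.hom_ext (RingHom.ext fun z => Subtype.ext ?_)
  change ((e ((normalizationInι V L).stalkMap x z) :
      integralClosure (V.presheaf.stalk (normalizationInι V L x)) L) : L) =
    algebraMap (V.presheaf.stalk (normalizationInι V L x)) L z
  rw [he, stalkToField_stalkMap, ← IsScalarTower.algebraMap_apply]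

/-- **Glue lemma A2 (registered form): the stalks of the normalization `W^L` of an integral
scheme `W` in a purely inseparable extension `L/K(W)` are the integral closures of the normal
stalks of `W`, compatibly with the stalk map.** For `x ∈ W^L` over `w = ι x` with `𝒪_{W,w}`
integrally closed, `integralClosure 𝒪_{W,w} L` is local
(`isLocalRing_integralClosure_of_isPurelyInseparable`), so
`nonempty_stalk_normalizationIn_iso_of_isLocalRing` applies. (The hypotheses cannot be dropped:
see the module docstring.) [cite: Liu2002, Def. 4.1.24, p. 155] -/
theorem nonempty_stalk_normalizationIn_iso_of_isPurelyInseparable : ∀ (W : Scheme.{0}) [IsIntegral W] (L : Type) [Field L] [Algebra W.functionField L] [Algebra.IsAlgebraic W.functionField L] [IsPurelyInseparable W.functionField L] (x : ↥(normalizationIn W L)), letI w : ↥W := (normalizationInι W L).base x; letI : Algebra (W.presheaf.stalk w) L := ((algebraMap W.functionField L).comp (algebraMap (W.presheaf.stalk w) W.functionField)).toAlgebra; IsIntegrallyClosed (W.presheaf.stalk w) → ∃ e : (normalizationIn W L).presheaf.stalk x ≅ CommRingCat.of (integralClosure (W.presheaf.stalk w) L), (normalizationInι W L).stalkMap x ≫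 e.hom = CommRingCat.ofHom (algebraMap (W.presheaf.stalk w) (integralClosure (W.presheaf.stalk w) L)) := by
  intro W _ L _ _ _ _ x hO
  letI : Algebra (W.presheaf.stalk (normalizationInι W L x)) L :=
    ((algebraMap W.functionField L).comp
      (algebraMap (W.presheaf.stalk (normalizationInι W L x)) W.functionField)).toAlgebra
  haveI : IsScalarTower (W.presheaf.stalk (normalizationInι W L x)) W.functionField L :=
    IsScalarTower.of_algebraMap_eq fun _ => rfl
  haveI : IsLocalRing (integralClosure (W.presheaf.stalk (normalizationInι W L x)) L) :=
    isLocalRing_integralClosure_of_isPurelyInseparable _ W.functionField L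
  exact nonempty_stalk_normalizationIn_iso_of_isLocalRing W L x

end Summit.ResolutionOfSingularities.ResolutionOfSingularities.Theorems.Picover.StalkNormalizationIn

end
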